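import Summits.QuantumFields.YangMills.Theorems.BalabanUVNodesK0AxCtabUniq
import Summits.QuantumFields.YangMills.Theorems.BalabanUVNodesPortTok182GaugeCriterion

/-!
# LENS-1 (◇ `ymgap-nodeO-lens-1` g10) — THE TUBE THEOREM: the receipt (C-tab-opt) `RootedResponseWeaklyCriticalAt`, AS TYPED, IMPLIES
# Tok-182 at `(θ, K, a, l)` — the J5′-FORBIDDEN identity `recordHr … = recordHrLocξ … univ …` (so (C-tab-opt) is struck as a supplier)

LANDING (porter PTC-1 g3, 2026-08-31): landed VERBATIM from the ideation cell's HOME sketch `nodeO-cover/LENS-1g10-CtabOptTube-v1.lean` (sha16 f0ee756e8265a14f, 113 l.,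
author seat ◇ lens-1 gen 10 «cauchy-analytic») under the basename ★★★ director-ym №542 (B)(i) named (`…K0AxCtabOptTube`), as a helper `--supports stmt-QuantumFields-27238 --as helper`;
◆ CRIT-1 g36's paper CUT of the chain = PASS (09:19:31Z), ★★★ №543 (2) adopted the re-key.  Only this paragraph was added.  HONEST: an IMPLICATION between two displayed predicates
((C-tab-opt) `RootedResponseWeaklyCriticalAt` AS TYPED ⟹ the J5′-forbidden identities), sorry-free, by name; `¬(C-tab-opt)` itself is NOT a kernel theorem here (the receipt is
STRUCK as a supplier ∕ SUSPECT-false-shaped, not refuted in Lean); nothing of Bałaban asserted, ported, discharged or refuted; K0⁷ ∕ K0ᴬ OPEN.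

Director-ym ★★★ №542 (B)(i) (2026-08-31T09:16Z); ◆ CRIT-1 g36 CUT of the chain = PASS (09:19:31Z).  Items: K0⁷ `Record13SepCoPHInhabited`
(stmt-QuantumFields-20541) ∕ K0ᴬ `Record13SepCoPHInhabitedAx` (stmt-QuantumFields-27238) — both OPEN; this file is linear algebra over the tree's
[B6] Sect. A model at the record's NAMES and proves an IMPLICATION between two displayed predicates; it asserts neither.

WHAT.  ✓`K0AxCtabUniq.RootedResponseWeaklyCriticalAt F θ k K a l` ((C-tab-opt), CtabUniq :177) says: entrywise, the chart-unit rooted response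
`ξ⁻¹·recordD a l · i i'` is WEAKLY CRITICAL for the GLOBAL linearised problem with the STRAIGHT constraint `Q_{k+1} A = r·e_l` ([B6] (2.5)–(2.6) at the
window `univ`).  By ✓`recordD_sub_recordHrLocξ_univ_of_weaklyCritical` this puts `recordD` on the RESTRICTED-gauge orbit of `recordHrLocξ univ = ξ·H₁e_l·ρ₈`:
`recordD − recordHrLocξ univ = ξ·(∂λ_re + i·∂λ_im)` with `λ ∈ N(Q′)` of DEF-1's window family at `univ`.  That family IS [B6]'s whole-torus family
(✓`PortTok182.windowDomains_univ_eq_whole`), where `N(Q′) = {λ : avg_{k+1} λ = 0}` (✓`B6SectAWholeTorusBridge.mem_ker_QpE_whole_iff`): the gauge potential has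
VANISHING — in particular CONSTANT — `(k+1)`-block means.  ▶ PTZ-1's selector-free criterion ✓`PortTok182.tok182At_iff_blockConst_of_gaugeShape` («under the
gauge shape `recordD = recordHrLocξ univ + ∂Φ`, Tok-182 at `(θ, K, a, l)` ⟺ the block means of `re∕im Φ` are constant», [B6] (2.12) uniqueness of the (21)-Landau
re-gauging) then gives Tok-182: ★★★ `tok182At_of_weaklyCritical`; entrywise ★ `recordHr_eq_recordHrLocξ_univ_of_weaklyCritical`; on the chart's `𝐔`-rows
★ `recordGkL_inl_eq_recordGkLocWξ_univ_inl_of_weaklyCritical` (`recordGkL = recordGkLocWξ univ` on `(b, 𝐔_c)`).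

WHY THIS STRIKES (C-tab-opt) AS A SUPPLIER (◆ J5′ «tube term»; CRIT-1 (3): Tok-182 FALSE-SHAPED · kernel-undecidable; ▶ PTZ-1 memo v2: the block means of the
true gauge potential are the comb∕flux data `−m + const`, NOT constant already at `k = 0`, `d = 4`; ★★ DEF-1 toy W2-4 v2, STATUS 2026-08-31T09:17:44Z: the rooted
objects MISS the straight-constraint surface by `|Q U − ξβ| = 0.139` while the record's comb-linearised constraint holds to 4e-12).  The rooted response obeys the
COMB-linearised constraint `(Q_{k+1} − ∂^{(k+1)}∘M) A = ξβ`, so it lies on the UNRESTRICTED gradient orbit of `ξ·H₁e_l·ρ₈` ((C-orb) = DEF-1 ed.21 `RootedOrbitRowAt`,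
TRUE-shaped: [15] (176)+(21)), not on the `N(Q′)`-orbit; (C-tab-opt)'s clause «weakly critical for `Q_{k+1}`» is the over-strong one.  Consequence: ✓`tableRowLT_of_weaklyCritical`
∕ ✓`recordHr_sub_recordHrLocξ_univ_of_weaklyCritical` ∕ ✓`tableRowLT_urows_of_weaklyCritical` stay theorems whose hypothesis is never expected to be inhabited at the
record; the supplier of `TableRowLT` ∕ `DressLink` is re-keyed to (C-orb) (★★★ №542 (iii)).

HONEST.  Sorry-free linear algebra BY NAME (PTZ-1's criterion + CtabUniq §5); an implication `(C-tab-opt) → Tok-182`; `¬(C-tab-opt)` is NOT a tree theorem here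
(the falsity of Tok-182 is ◆'s ∕ PTZ-1's ∕ DEF-1's numerics, not a kernel fact); nothing of Bałaban ([15] Prop. 9, (176)–(178), (182); [B6] (2.35); [I] (4.35)) is
asserted, ported or discharged; K0⁷ 20541 ∕ K0ᴬ 27238 OPEN; NODE O 0∕1; COUNT 8∕28 · K 1∕4 UNMOVED; finite `𝕋⁴_{L^K}` at fixed ε — NOT continuum ∕ OS ∕ Clay;
**the Yang–Mills mass gap is NOT proved.**  No `instance`, `notation`, `allowUnsafeReducibility`; standard axioms.
-/

noncomputable section

open scoped InnerProductSpace BigOperators Matrix.Norms.L2Operator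

namespace Summit.QuantumFields.YangMills.Theorems.K0AxCtabUniq

open Literature.MathematicalPhysics.QuantumFieldTheory.Balaban1983to89
open LatticeFieldCalculus B6SectADomainsV1 B6SectAOperatorsV1
open Summit.QuantumFields.YangMills.Theorems.K0RecordFormatNames
open Literature.MathematicalPhysics.QuantumFieldTheory.Balaban1983to89.T4Continuum (T4Family)
open Literature.MathematicalPhysics.QuantumFieldTheory.Balaban1983to89.Node00
open Literature.MathematicalPhysics.QuantumFieldTheory.BalabanImbrieJaffe1984to88.BIJ85GaugeFunction5113 (siteAvgIter_smul)

variable (F : T4Family)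

/-- At the window `univ`, `N(Q′)` is «vanishing `(k+1)`-fold block average» ([B5] p.25): DEF-1's window family at `univ` is [B6]'s whole-torus family
(✓`PortTok182.windowDomains_univ_eq_whole`) and ✓`mem_ker_QpE_whole_iff`. [cite: Balaban1984PropagatorsII, (2.10) p.225; Balaban1984PropagatorsI, p.25 (text)] -/
theorem siteAvgIter_eq_zero_of_mem_ker_univ (k K : ℕ) (hk : k + 1 ≤ (F.P K).m + (F.P K).K) {n : ScalarSpace (F.P K)}
    (hn : n ∈ LinearMap.ker (QpE (univDomains F k K hk))) : siteAvgIter (k + 1) (WithLp.ofLp n) = 0 := by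
  have hn' : n ∈ LinearMap.ker (QpE (Domains.whole (P := F.P K) (k + 1) hk)) := by
    rw [← PortTok182.windowDomains_univ_eq_whole F hk]
    exact hn
  exact (B6SectAWholeTorusBridge.mem_ker_QpE_whole_iff hk n).mp hn'

variable (θ : Stage13Params F 2)

/-- ★★★ **THE TUBE THEOREM — (C-tab-opt), AS TYPED, IMPLIES Tok-182 at `(θ, K, a, l)`**: if the rooted response is weakly critical for the STRAIGHT-constraint
global problem, then `recordHr a l = recordHrLocξ univ a l` on EVERY fine bond (as `2 × 2` matrices) — the restricted gauge `ξ∂λ`, `λ ∈ N(Q′)`, of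
✓`recordD_sub_recordHrLocξ_univ_of_weaklyCritical` has vanishing `(k+1)`-block means, hence is invisible to the (21)-Landau re-gauging (PTZ-1's criterion
✓`tok182At_iff_blockConst_of_gaugeShape`, [B6] (2.12) uniqueness).  ◆ J5′: the consequent is the tube-term identity, false-shaped at the record; `¬` of either side
is NOT claimed here. [cite: Balaban1985Variational, (176)–(178) p.306, (182) p.307, (21) p.281, Prop. 9 p.309; Balaban1984PropagatorsII, (2.12) p.225, (2.35) p.228; Balaban1987RG1, (4.35) p.290] -/
theorem tok182At_of_weaklyCritical (k K : ℕ) (hk : k + 1 ≤ (F.P K).m + (F.P K).K) (a : θ.ιβ) (l : RespLabel F k K)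
    (h : RootedResponseWeaklyCriticalAt F θ k K a l) :
    ∀ b : PBond (F.P K) 0, recordHr F θ k K a l b = recordHrLocξ F θ k K Finset.univ a l b := by
  choose n m hn hm hD using fun i i' => recordD_sub_recordHrLocξ_univ_of_weaklyCritical F θ k K hk a l h i i'
  set ξ : ℝ := (F.P K).eta (k + 1) with hξ
  -- the gauge shape: `recordD = recordHrLocξ univ + ∂Φ`, `Φ = ξ·(λ_re + i·λ_im)` entrywise
  let Φ : Site (F.P K) 0 → Fin 2 → Fin 2 → ℂ := fun y i i' =>
    (ξ : ℂ) * ((WithLp.ofLp (n i i') y : ℂ) + (WithLp.ofLp (m i i') y : ℂ) * Complex.I)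
  have hT : ∀ (b : PBond (F.P K) 0) (i i' : Fin 2),
      recordD F θ k K a l b i i' = recordHrLocξ F θ k K Finset.univ a l b i i' + (Φ b.tgt i i' - Φ b.src i i') := by
    intro b i i'
    have e := hD i i' b
    simp only [ofLp_dE, grad, one_smul, Complex.ofReal_sub] at e
    simp only [Φ]
    linear_combination e
  refine (PortTok182.tok182At_iff_blockConst_of_gaugeShape F hk θ a l Φ hT).2 fun i i' => ⟨⟨0, ?_⟩, ⟨0, ?_⟩⟩
  · have hre : (fun y => (Φ y i i').re) = ξ • WithLp.ofLp (n i i') := by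
      funext y
      simp [Φ, Complex.mul_re]
    rw [hre, siteAvgIter_smul, siteAvgIter_eq_zero_of_mem_ker_univ F k K hk (hn i i'), smul_zero]
    rfl
  · have him : (fun y => (Φ y i i').im) = ξ • WithLp.ofLp (m i i') := by
      funext y
      simp [Φ, Complex.mul_im]
    rw [him, siteAvgIter_smul, siteAvgIter_eq_zero_of_mem_ker_univ F k K hk (hm i i'), smul_zero]
    rfl

/-- ★ **Entrywise form** (★★★ №542 (B)(i)'s literal): under (C-tab-opt), `recordHr a l b i i' = recordHrLocξ univ a l b i i'` for every fine bond and entry.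
[cite: Balaban1985Variational, (176) p.306, (21) p.281; Balaban1984PropagatorsII, (2.12) p.225; Balaban1987RG1, (4.35) p.290] -/
theorem recordHr_eq_recordHrLocξ_univ_of_weaklyCritical (k K : ℕ) (hk : k + 1 ≤ (F.P K).m + (F.P K).K) (a : θ.ιβ) (l : RespLabel F k K)
    (h : RootedResponseWeaklyCriticalAt F θ k K a l) :
    ∀ (b : PBond (F.P K) 0) (i i' : Fin 2), recordHr F θ k K a l b i i' = recordHrLocξ F θ k K Finset.univ a l b i i' :=
  fun b i i' => by rw [tok182At_of_weaklyCritical F θ k K hk a l h b]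

/-- ★ **… hence the `𝐔`-rows identity `recordGkL = recordGkLocWξ univ`** (the other J5′-forbidden bridge, NamesL :120 ∕ LocC :86: both `𝐔`-blocks are `sl2Coord` of
the respective matrices). [cite: Balaban1987RG1, (4.35) p.290, (1.9) p.261; Balaban1985Variational, (176) p.306] -/
theorem recordGkL_inl_eq_recordGkLocWξ_univ_inl_of_weaklyCritical (k K : ℕ) (hk : k + 1 ≤ (F.P K).m + (F.P K).K) (a : θ.ιβ) (l : RespLabel F k K)
    (h : RootedResponseWeaklyCriticalAt F θ k K a l) (b : PBond (F.P K) 0) (c : Fin 3) :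
    recordGkL F θ k K a l (chartEquivJ F K (b, Sum.inl c)) = recordGkLocWξ F θ k K Finset.univ a l (chartEquivJ F K (b, Sum.inl c)) := by
  have hM : (Matrix.of fun i i' => recordHr F θ k K a l b i i') = Matrix.of fun i i' => recordHrLocξ F θ k K Finset.univ a l b i i' := by
    ext i i'
    simp only [Matrix.of_apply, tok182At_of_weaklyCritical F θ k K hk a l h b]
  simp only [recordGkL, recordGkLocWξ, Equiv.symm_apply_apply, Sum.elim_inl, hM]

end Summit.QuantumFields.YangMills.Theorems.K0AxCtabUniq

end
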